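import Summits.Parity.GeneralizedHardyLittlewood.Theorems.GreenTaoLevelTwoGITwoCyclicInverseQuadruples
import Mathlib.Algebra.Order.Chebyshev

/-!
# Route `GreenTaoLevelTwo`, crux `GITwo` (stmt-Parity-21275), line `birth`, stub `stub_cyclicInverse`:
# the Cauchy–Schwarz / van der Corput step (GT08a arXiv Lemma 22)

Thirty-seventh helper file toward the XL stub `stub_cyclicInverse` (B. Green, T. Tao, *An inverse
theorem for the Gowers `U³(G)` norm*, arXiv:math/0503014, Thm. 68 = PEMS 51 (2008) Thm. 12.8).
arXiv Lemma 22 (§4) is the device "apply Cauchy–Schwarz to eliminate the bounded function `b(x)`"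
used throughout the symmetry argument (arXiv Lemma 46, block C12) and §9 Steps 3–4 (block C13).
Sum form, def-free:

* `norm_sum_mul_sum_sq_le` — `‖Σ_{x∈X} b(x) Σ_{y∈Y} f(x,y)‖² ≤ #X · Σ_{x∈X} ‖Σ_{y∈Y} f(x,y)‖²`
  for `‖b‖ ≤ 1` on `X`;
* `ofReal_sum_norm_sum_sq` — `Σ_x ‖Σ_y f(x,y)‖² = Σ_x Σ_{y'} Σ_y f(x,y') conj f(x,y)` (in `ℂ`);
* `sum_sum_eq_sum_sum_shift` — the van der Corput substitution `y' = y + h` over `ℤ/Mℤ`: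
  `Σ_{y'} Σ_y g(y', y) = Σ_h Σ_y g(y + h, y)`.

References: [GreenTao2008U3Inverse] arXiv:math/0503014, Lemma 22 and display (vdc).
-/

noncomputable section

namespace Summit.Parity.GeneralizedHardyLittlewood.GreenTaoLevelTwoGITwoCyclicInverse

open Finset
open scoped ComplexConjugate

/-- **GT08a arXiv Lemma 22 (Cauchy–Schwarz), sum form**: for finsets `X, Y`, `f : X × Y → ℂ` and a
bounded weight `‖b(x)‖ ≤ 1` on `X`:
`‖Σ_{x∈X} b(x) Σ_{y∈Y} f(x,y)‖² ≤ #X · Σ_{x∈X} ‖Σ_{y∈Y} f(x,y)‖²`.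
[cite: GreenTao2008U3Inverse, Lemma 22] -/
theorem norm_sum_mul_sum_sq_le {α β : Type*} (X : Finset α) (Y : Finset β) (f : α → β → ℂ)
    (b : α → ℂ) (hb : ∀ x ∈ X, ‖b x‖ ≤ 1) :
    ‖∑ x ∈ X, b x * ∑ y ∈ Y, f x y‖ ^ 2 ≤ #X * ∑ x ∈ X, ‖∑ y ∈ Y, f x y‖ ^ 2 := by
  have h1 : ‖∑ x ∈ X, b x * ∑ y ∈ Y, f x y‖ ≤ ∑ x ∈ X, ‖∑ y ∈ Y, f x y‖ := by
    refine (norm_sum_le _ _).trans (sum_le_sum fun x hx => ?_)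
    rw [norm_mul]
    calc ‖b x‖ * ‖∑ y ∈ Y, f x y‖ ≤ 1 * ‖∑ y ∈ Y, f x y‖ :=
          mul_le_mul_of_nonneg_right (hb x hx) (norm_nonneg _)
      _ = ‖∑ y ∈ Y, f x y‖ := one_mul _
  calc ‖∑ x ∈ X, b x * ∑ y ∈ Y, f x y‖ ^ 2 ≤ (∑ x ∈ X, ‖∑ y ∈ Y, f x y‖) ^ 2 :=
        pow_le_pow_left₀ (norm_nonneg _) h1 2
    _ ≤ #X * ∑ x ∈ X, ‖∑ y ∈ Y, f x y‖ ^ 2 := sq_sum_le_card_mul_sum_sq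

/-- The expansion `Σ_x ‖Σ_y f(x,y)‖² = Σ_x Σ_{y'} Σ_y f(x,y') conj f(x,y)` (as complex numbers).
[cite: GreenTao2008U3Inverse, Lemma 22] -/
theorem ofReal_sum_norm_sum_sq {α β : Type*} (X : Finset α) (Y : Finset β) (f : α → β → ℂ) :
    ((∑ x ∈ X, ‖∑ y ∈ Y, f x y‖ ^ 2 : ℝ) : ℂ) =
      ∑ x ∈ X, ∑ y' ∈ Y, ∑ y ∈ Y, f x y' * conj (f x y) := by
  rw [Complex.ofReal_sum]
  refine sum_congr rfl fun x _ => ?_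
  rw [ofReal_norm_sq_eq_mul_conj, map_sum, sum_mul_sum]

/-- **The van der Corput substitution** over `ℤ/Mℤ`: `Σ_{y'} Σ_y g(y', y) = Σ_h Σ_y g(y + h, y)`.
[cite: GreenTao2008U3Inverse, display (vdc)] -/
theorem sum_sum_eq_sum_sum_shift {M : ℕ} [NeZero M] {γ : Type*} [AddCommMonoid γ]
    (g : ZMod M → ZMod M → γ) :
    ∑ y' : ZMod M, ∑ y : ZMod M, g y' y = ∑ h : ZMod M, ∑ y : ZMod M, g (y + h) y := by
  rw [Finset.sum_comm]
  conv_rhs => rw [Finset.sum_comm]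
  refine sum_congr rfl fun y _ => ?_
  exact (Equiv.sum_comp (Equiv.addRight y) (fun y' => g y' y)).symm.trans
    (sum_congr rfl fun h _ => by simp [Equiv.addRight, add_comm])

end Summit.Parity.GeneralizedHardyLittlewood.GreenTaoLevelTwoGITwoCyclicInverse
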